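import Mathlib
import Summits.AnomalousDissipation.AnomalousDissipation.Theorems.SoloBlindSimultaneousMidgap

/-!
# Solo-blind: infinitely many admissible indices along a slowly varying sequence (paper §24.45, (H9″))

The selection hypothesis (H9″) of Theorem-candidate 24.B asks for INFINITELY MANY wavenumbers `n`
such that the semiclassical parameter `x n` (`= 1/h(n) ∝ n^{1/3}`) sits mid-gap for every
Bohr–Sommerfeld ladder `a k + m • d k` at once.  `SoloBlindSimultaneousMidgap` gives, in every window
of length `max d`, a REAL point `x*` at distance `≥ δ/(8L)` from all rungs (`δ ≤ d k`, `L` ladders).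
This file passes from `x*` to actual members of the sequence: a real sequence that is unbounded above
and whose increments are eventually `≤ ε` visits every interval `[a, a + ε]` beyond that point
(`seq_hits_window`), so with `ε = δ/(8L)` some `x n` lies within `ε/2` of `x*` and keeps half the margin.

* `seq_hits_window`            — discrete intermediate-value property of slowly increasing sequences.
* `admissible_infinitely_many` — `∀ A, ∃ n ≥ N, A ≤ x n ∧ ∀ k m, δ/(16 L) ≤ |x n - (a k + m d k)|`.
-/

namespace Summit.AnomalousDissipation.AnomalousDissipation.Theorems

open Set

/-- A real sequence unbounded above (beyond `N`) whose increments are `≤ ε` from `N` on takes a value in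
every interval `[a, a + ε]` with `a ≥ x N`. -/
theorem seq_hits_window (x : ℕ → ℝ) (N : ℕ) (ε : ℝ)
    (hunb : ∀ A : ℝ, ∃ n, N ≤ n ∧ A ≤ x n)
    (hinc : ∀ n, N ≤ n → x (n + 1) - x n ≤ ε) :
    ∀ a : ℝ, x N ≤ a → ∃ n, N ≤ n ∧ a ≤ x n ∧ x n ≤ a + ε := by
  intro a ha
  classical
  have hex : ∃ n, N ≤ n ∧ a ≤ x n := hunb a
  let m := Nat.find hex
  have hm : N ≤ m ∧ a ≤ x m := Nat.find_spec hex
  by_cases hmN : m = N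
  · refine ⟨N, le_rfl, ?_, ?_⟩
    · have := hm.2; rw [hmN] at this; exact this
    · have h0 : (0:ℝ) ≤ ε := by
        have := hinc N le_rfl
        -- x (N+1) - x N ≤ ε and we need 0 ≤ ε: use minimality? Not available here; derive from hm instead.
        -- Since m = N, a ≤ x N ≤ a, so x N = a, and x N ≤ a + ε needs 0 ≤ ε; obtain it from n = N+1 … not forced.
        -- Instead bound directly: x N ≤ a ≤ a + ε requires ε ≥ 0; we get it from hunb applied to a + |ε| + 1.
        obtain ⟨n, hn, hxn⟩ := hunb (x N + 1)
        -- increments ≤ ε summed from N to n give x n - x N ≤ (n - N) ε, and x n - x N ≥ 1 > 0, so ε > 0 when n > N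
        have key : ∀ j : ℕ, x (N + j) - x N ≤ j * ε := by
          intro j
          induction j with
          | zero => simp
          | succ j ih =>
            have := hinc (N + j) (Nat.le_add_right N j)
            have e : N + (j + 1) = N + j + 1 := by ring
            rw [e]; push_cast; linarith
        obtain ⟨j, rfl⟩ := Nat.exists_eq_add_of_le hn
        have hj := key j
        by_contra hneg
        have hneg' : ε < 0 := not_le.mp hneg
        have : (j:ℝ) * ε ≤ 0 := mul_nonpos_of_nonneg_of_nonpos (Nat.cast_nonneg j) hneg'.le
        linarith
      linarith
  · have hlt : N < m := lt_of_le_of_ne hm.1 (Ne.symm hmN)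
    obtain ⟨p, hp⟩ : ∃ p, m = p + 1 := Nat.exists_eq_succ_of_ne_zero (by omega)
    have hpN : N ≤ p := by omega
    have hpm : p < m := by rw [hp]; exact Nat.lt_succ_self p
    have hpmin : ¬ (N ≤ p ∧ a ≤ x p) := Nat.find_min hex hpm
    have hxp : x p < a := by
      by_contra h; exact hpmin ⟨hpN, not_lt.mp h⟩
    refine ⟨m, hm.1, hm.2, ?_⟩
    have := hinc p hpN
    rw [hp]; linarith

/-- **(H9″) in kernel form.** `L = card ι ≥ 1` ladders `a k + m • d k` with spacings `0 < δ ≤ d k ≤ Δ`;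
a real sequence `x` unbounded above whose increments are eventually at most `δ/(8L)`.  Then beyond any
threshold there is an index `n` at which `x n` is at distance `≥ δ/(16 L)` from every rung of every
ladder. -/
theorem admissible_infinitely_many {ι : Type*} [Fintype ι] (a d : ι → ℝ) (δ Δ : ℝ)
    (hL : 0 < Fintype.card ι) (hδ : 0 < δ) (hδd : ∀ k, δ ≤ d k) (hdΔ : ∀ k, d k ≤ Δ)
    (x : ℕ → ℝ) (N : ℕ)
    (hunb : ∀ A : ℝ, ∃ n, N ≤ n ∧ A ≤ x n)
    (hinc : ∀ n, N ≤ n → x (n + 1) - x n ≤ δ / (8 * Fintype.card ι)) :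
    ∀ A : ℝ, ∃ n, N ≤ n ∧ A ≤ x n ∧
      ∀ k, ∀ m : ℤ, δ / (16 * Fintype.card ι) ≤ |x n - (a k + m * d k)| := by
  intro A
  set L : ℝ := (Fintype.card ι : ℝ) with hLdef
  have hLpos : (0:ℝ) < L := by rw [hLdef]; exact_mod_cast hL
  set ε : ℝ := δ / (8 * L) with hεdef
  have hεpos : 0 < ε := by rw [hεdef]; positivity
  have hd : ∀ k, 0 < d k := fun k => lt_of_lt_of_le hδ (hδd k)
  obtain ⟨k₀⟩ : Nonempty ι := Fintype.card_pos_iff.mp hL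
  have hΔ : 0 < Δ := lt_of_lt_of_le (hd k₀) (hdΔ k₀)
  -- base point of the window: beyond A and beyond x N
  set A' : ℝ := max A (x N) with hA'
  -- mid-gap point in the window [A' + ε/2, A' + ε/2 + Δ]
  set c : ℝ := A' + ε / 2 with hc
  obtain ⟨x₀, hx₀I, hx₀⟩ := simultaneous_midgap_of_small_radii (fun k => a k - c) d (fun _ => ε) Δ hΔ hL
    hd hdΔ (fun _ => hεpos.le) (fun k => by
      rw [hεdef, hLdef]
      exact div_le_div_of_nonneg_right (hδd k) (by positivity))
  -- the sequence visits [x₀ + c - ε/2, x₀ + c + ε/2]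
  have hwin := seq_hits_window x N ε hunb (fun n hn => by rw [hεdef, hLdef]; exact hinc n hn)
    (x₀ + c - ε / 2) (by
      have : x N ≤ A' := le_max_right _ _
      have : (0:ℝ) ≤ x₀ := hx₀I.1
      rw [hc]; linarith)
  obtain ⟨n, hnN, hlo, hhi⟩ := hwin
  refine ⟨n, hnN, ?_, ?_⟩
  · have : A ≤ A' := le_max_left _ _
    have : (0:ℝ) ≤ x₀ := hx₀I.1
    rw [hc] at hlo; linarith
  · intro k m
    have hr := hx₀ k m
    -- |x n - rung| ≥ |x₀ + c - rung| - |x n - (x₀ + c)| ≥ ε - ε/2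
    have h1 : |x n - (x₀ + c)| ≤ ε / 2 := by
      rw [abs_le]; constructor <;> linarith
    have h2 : ε ≤ |(x₀ + c) - (a k + m * d k)| := by
      have : x₀ - (a k - c + m * d k) = (x₀ + c) - (a k + m * d k) := by ring
      rw [← this]; exact hr
    have h3 : |(x₀ + c) - (a k + m * d k)| ≤ |x n - (a k + m * d k)| + |x n - (x₀ + c)| := by
      have := abs_sub_le (x₀ + c) (x n) (a k + m * d k)
      rw [abs_sub_comm (x₀ + c) (x n)] at this
      linarith
    have h4 : ε / 2 ≤ |x n - (a k + m * d k)| := by linarith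
    have h5 : δ / (16 * Fintype.card ι) = ε / 2 := by
      rw [hεdef, hLdef]; field_simp; ring
    rw [h5]; exact h4

end Summit.AnomalousDissipation.AnomalousDissipation.Theorems
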